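import Literature.NumberTheory.EllipticCurves.Skinner2016.RankZeroPPart
import Literature.NumberTheory.EllipticCurves.Selmer
import HarnessLib

/-!
# Skinner 2016, Theorem C, clause (2): `L(E, 1) = 0 ⟹ corank_{ℤ_p} Sel_{p^∞}(E) ≥ 1`, at a prime
# `p ≥ 3` of good ordinary OR multiplicative reduction, under (irr) + (ram) — AS PRINTED
# (cited-only named fact) + its contrapositive corollaries (corank `0` ⇒ `L(E,1) ≠ 0` ⇒ `r_an = 0`)

Source: C. Skinner, *Multiplicative reduction and the cyclotomic main conjecture for* `GL₂`,
Pacific J. Math. 283 (2016), no. 1, 171–200, doi:10.2140/pjm.2016.283.171 (= arXiv:1407.1093), §1,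
Theorem C (a special case of his Theorem B, itself a consequence of Theorem A = the cyclotomic
Iwasawa–Greenberg main conjecture for `p`-ordinary newforms with `p ∣ N` allowed; bib
`Skinner2016PacificMC`). PRIMARY READ 2026-08-23 on the held text `paper:arxiv-1407.1093`
(`lit read arxiv:1407.1093 --pages 1-4`; `p0003.txt` = arXiv p. 3 = PJM p. 173): Theorem B
L60–L86 ("In particular, if `L(f,1)=0`, then `Sel_L(f)` has `𝒪`-corank at least one", L86),
Theorem C L103–L115, clause (2) at L115.

This file is the SIBLING of `Skinner2016/RankZeroPPart.lean`, whose named fact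
`Literature.NumberTheory.EllipticCurves.Skinner2016.thmC_padicValRat_bsd_rank_zero` (registry row
A2) transcribes Theorem C's clause (1) only ("Only the first conclusion (`L(E,1) ≠ 0`) is
transcribed"). Here clause **(2)** is transcribed, with the binder block of clause (1) BYTE FOR
BYTE (`W` globally minimal elliptic, `p` with `[Fact p.Prime]`, `3 ≤ p`, `_hred` = good ordinary
OR multiplicative AS PRINTED — not narrowed to the multiplicative case —, `_hirr`, `_hram`) minus
`_hL` / `_hfin`, plus `(_hL : W.entireLFunction 1 = 0)`, conclusion `1 ≤ W.selmerCorank p`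
(`WeierstrassCurve.selmerCorank W p = zpCorank (Sel_{p^∞}(E/ℚ)) p`, file `Selmer`: Greenberg's
`ℤ_p`-corank of the `p^∞`-Selmer group — the tree's standing reading, as in
`SkinnerUrban2014.thm3611b_one_le_selmerCorank_of_entireLFunction_one_eq_zero` and
`Literature/Barriers/BirchSwinnertonDyer/SelmerVersusMordellWeil.lean`).

HONEST FRAMING (cell `b2b-bsdres`, run/shared/lean/b2b/bsd-rank1-residual/; BSD-DENSITY SPRINT,
cell book `cells/density/CONVERSION-QUEUE.md` v0 §2 row Q1 / §5; lend T-id **T-DENS-Q1I** FILE 2,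
cc-lead GEN 85 ADDENDUM 2, registry word q-cc-1 = YES, lit GEN 112 close (HOME INBOX l.15741
(3))): the statement below is a SENTENCE typed VERBATIM AS PRINTED from a refereed primary, with
its hypotheses complete; it is a `def … : Prop` consumed BY NAME as a hypothesis — it proves
nothing, books nothing and moves no density number, mark, label, count or tier. It is the
PUB-primary corank currency of the MULTIPLICATIVE leg of the density binder **`h5`** of
`Literature.NumberTheory.EllipticCurves.bsz_rankLeOne_cRank_of_pieces`
(`LeadingTermBSZResCellAssemblyProofs.lean`; "`#Sel₅(E) = 1 ⇒ rank = 0 ∧ r_an = 0` on `S₀(5) ∩ W`")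
by contraposition (corank `0` ⇒ `L(E,1) ≠ 0`); by-name consumer of record = the glue seat D2
(`b2b-bsdres-dens-p1`), instantiating `p = 5`. Net debt `+1` (D-0026), consumer named; referee
page-read asked at landing. Typed by cc-typer-3 GEN 16 (lent typer).

## The printed statement (verbatim; `p0003.txt` L103–L115)

**Theorem C.** "Let `E` be an elliptic curve over `ℚ` with good ordinary or multiplicative
reduction at a prime `p ≥ 3`. Suppose that (i) `E[p]` is an irreducible
`Gal(ℚ̄/ℚ)`-representation; (ii) there exists a prime `q ≠ p` at which `E` has multiplicative
reduction and `E[p]` is ramified. If `L(E,1) ≠ 0` then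
`|L(E,1)/Ω_E|_p^{-1} = |#Ш(E) ∏_ℓ c_ℓ(E)|_p^{-1}`, and if `L(E,1) = 0` then `Sel_{p^∞}(E)` has
`ℤ_p`-corank at least one." (L101–L102: "As a special case of Theorem B, obtained by taking `f`
to be the newform associated with an elliptic curve `E` over `ℚ`".) Integrality at `p = 3`
(footnote 1, §2.5 of the source: irreducibility + the ramified multiplicative prime replace Kato's
`SL₂(ℤ_p)`-image hypothesis) concerns the equality in `Λ` behind clause (1) and is recorded in the
sibling file's module docstring; clause (2) is a corank statement and needs only the rational
equality, but the registry's `p = 3` flag below travels with every Skinner–Urban-descended fact.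

## Dictionary (one line per clause; conventions of A2 = clause (1))

* "a prime `p ≥ 3`" = `(p : ℕ) [Fact p.Prime] (_hp : 3 ≤ p)`; "good ordinary or multiplicative
  reduction at `p`" = `_hred : (W.HasGoodReductionAtPrime p ∧ ¬ (p : ℤ) ∣ W.frobeniusTrace p) ∨
  W.HasMultiplicativeReductionAtPrime p`.
* (i) = `_hirr : W.HasIrreducibleModPGaloisRep p`.
* (ii) = `_hram : ∃ ℓ, ∃ _ : Fact ℓ.Prime, ℓ ≠ p ∧ W.HasMultiplicativeReductionAtPrime ℓ ∧
  ¬ p ∣ padicValInt ℓ W.minimalDiscriminantInt` (multiplicative `ℓ ≠ p`; "`E[p]` ramified at `ℓ`"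
  ⟺ `p ∤ v_ℓ(Δ_min)`, Tate's parametrisation — A2's `_hram`, S–U's `haux`).
* "`L(E,1) = 0`" = `_hL : W.entireLFunction 1 = 0`; "`Sel_{p^∞}(E)` has `ℤ_p`-corank at least one"
  = `1 ≤ W.selmerCorank p`.

## Status / the `p = 3` reading (registry wording, verbatim; A1 / A2 / A3 / A16 carry it;
## referee A R152.2, lit GEN 62 block S-g62-1)

Tier (registry's words): PUB primary, "`p ≥ 3`" printed; the tier word on the A-row is lit's, K1
placement bsd-director's. The `p = 3` reading: Thm 5 prints "p odd", so p = 3 is INSIDE the print;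
its inputs at p = 3 are Skinner–Urban 2014 Thm 3.6.9 / 3.6.11 (A16 / A1) and Skinner 2016 Thms A /
C (A31 / A2), whose registry status is **PUB (p ≥ 5; flag `SU14-12.3.6-mu@nonsplit`
informational, R146.6; printed repair Wan 2015 Lemma 87 / Thm 101 / Thm 103, each "p ≥ 5") ·
PUB\* AT p = 3 — flag `SU14-12.3.6-mu@nonsplit@3` ACTIVE-PRINT-GAP (R152.2: gap active at every
p = 3 instance — the (ram) prime q is inert in K with q ∈ Σ, the w ∣ q factor of (12.3.5.b) is
(q² − 1)/q², 3 ∣ q² − 1 for every q ≠ 3; refereed repair at p = 3: NONE located (no S–U erratum in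
Crossref; BCS IMRN 2025 "p > 3"; Wan Thm 86's proof excludes p = 3); a non-[SU] road at `3` is
announced only for `N` square-free — BSTW arXiv:2409.01350v2 Thm. 10.10 (a) (zeta elements; Rem.
10.11), PRE, typed as the OPEN binder
`BurungaleSkinnerTianWan2024.thm1010a_mainStatement_semistable_ordinary_OPEN` (whose STATEMENT
already follows from `skinner_urban_main_conjecture`:
`…thm1010a_mainStatement_semistable_ordinary_OPEN_of_skinnerUrban`); BSTW's own Thm. 9.21 (c) / Thm.
12.3 at `p = 3` run through [SU] Thm. 3.29 under (ram))**. Hence this fact is usable AS PRINTED at p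
≥ 5
(«literal-sec» pending referee A); at p = 3 it INHERITS PUB\* / ACTIVE-PRINT-GAP and is not to be
instantiated at 3 by any class theorem without the flag travelling; the density-sprint consumer
instantiates p = 5 only. (Wording written for BSZ Thm 5 = the sibling T-DENS-Q1I fact
`BhargavaSkinnerZhang2014.thm5_rank_zero_of_pSelmer_trivial`; it applies verbatim to this clause
of Theorem C, which IS "Skinner 2016 Thm C (A2)" at `p = 3`.)

## Dedup (`lean search` + `grep CITED-FACTS.md`, 2026-08-23, this seat; registry dedup "clear",
## lit GEN 112)

* `Skinner2016/RankZeroPPart.lean` transcribes clause (1) only (`thmC_padicValRat_bsd_rank_zero`,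
  A2; A3 `Skinner2016_padicValRat_bsd_rank_zero` its DUP): clause (2) is new.
* `SkinnerUrban2014.thm3611b_one_le_selmerCorank_of_entireLFunction_one_eq_zero` (kernel theorem,
  p238343) is Skinner–Urban's Thm. 3.6.11 (b): GOOD ORDINARY `p` only, proved below A16
  `skinner_urban_main_conjecture`; the (ram)-free
  `one_le_selmerCorank_of_entireLFunction_one_eq_zero_of_mainConjecture`
  (`BSDSelmerPConverseRankZeroProofs.lean`, BCS 2025) is good ordinary `p ≥ 5`. Neither covers a
  MULTIPLICATIVE `p`; A31 `Skinner2016.thmA_charIdeal_multiplicative` (Thm. A, the main conjecture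
  at `p ‖ N`) is a `Λ`-statement whose control + interpolation glue to a corank statement at a
  multiplicative `p` (split case: trivial zero / `ℒ`-invariant) is not in the tree — hence this
  clause is vendored as printed rather than derived.

Proved here (theorems): `entireLFunction_one_ne_zero_of_selmerCorank_eq_zero_of_thmC` (the
contrapositive: corank `0` ⇒ `L(E,1) ≠ 0`) and
`analyticRank_eq_zero_of_selmerCorank_eq_zero_of_thmC` (⇒ `ord_{s=1} L(E,s) = 0`, Mathlib's
`analyticOrderAt_eq_zero`), for both legs, and the multiplicative leg displayed
(`…_of_multiplicative_of_thmC`). Nothing is asserted; no `_holds` is expected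
(Kato's Euler system, the three-variable Eisenstein divisibility and Hida theory at `p ∣ N` are not
in Mathlib or the tree).

## References

* C. Skinner, Pacific J. Math. 283 (2016) 171–200, Thm. C (§1, p. 173), Thm. B, footnote 1, §2.5.
  [Skinner2016PacificMC]
* C. Skinner, E. Urban, Invent. Math. 195 (2014), Thm. 2 (b) = Thm. 3.6.11 (b). [SkinnerUrban2014]
* R. Greenberg, LNM 1716 (1999), §1–2 (`ℤ_p`-coranks of Selmer groups). [GreenbergLNM1716]
-/

noncomputable section

open scoped Classical

open WeierstrassCurve

namespace Literature.NumberTheory.EllipticCurves.Skinner2016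

/-- **Skinner 2016, Theorem C, clause (2)** (Pacific J. Math. 283 (2016), §1, p. 173; =
arXiv:1407.1093 p. 3, held text `paper:arxiv-1407.1093` p0003 L103–L115), as printed: "Let `E` be
an elliptic curve over `ℚ` with good ordinary or multiplicative reduction at a prime `p ≥ 3`.
Suppose that (i) `E[p]` is an irreducible `Gal(ℚ̄/ℚ)`-representation; (ii) there exists a prime
`q ≠ p` at which `E` has multiplicative reduction and `E[p]` is ramified. If `L(E,1) ≠ 0` then
`|L(E,1)/Ω_E|_p^{-1} = |#Ш(E) ∏_ℓ c_ℓ(E)|_p^{-1}`, and if `L(E,1) = 0` then `Sel_{p^∞}(E)` has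
`ℤ_p`-corank at least one." This is clause (2) ("if `L(E,1) = 0` …") of the theorem whose clause
(1) is `thmC_padicValRat_bsd_rank_zero` (sibling file `RankZeroPPart`, registry row A2);
transcription with THAT fact's binders byte for byte (`W` a globally minimal model; `_hred` = good
ordinary (`p ∤ a_p`) OR multiplicative, as printed; (i) = `_hirr`; (ii) = `_hram` via Tate's
parametrisation: multiplicative `ℓ ≠ p` with `p ∤ v_ℓ(Δ_min)`) minus `_hL` / `_hfin`, plus
`_hL : L(E,1) = 0`; conclusion `1 ≤ corank_{ℤ_p} Sel_{p^∞}(E/ℚ)` = `1 ≤ W.selmerCorank p`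
(file `Selmer`). STATUS (registry wording): PUB primary, "`p ≥ 3`" printed; the `p = 3` READING —
inputs Skinner–Urban 2014 Thm 3.6.9 (A16) / Skinner 2016 Thm A (A31): PUB at `p ≥ 5`, PUB\* at
`p = 3` with flag `SU14-12.3.6-mu@nonsplit@3` ACTIVE-PRINT-GAP (referee A R152.2; no refereed repair
at `p = 3` located; a non-[SU] road at `3` is announced only for `N` square-free — BSTW
arXiv:2409.01350v2 Thm. 10.10 (a) (zeta elements; Rem. 10.11), PRE, typed as the OPEN binder
`BurungaleSkinnerTianWan2024.thm1010a_mainStatement_semistable_ordinary_OPEN` (whose STATEMENT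
already follows from `skinner_urban_main_conjecture`:
`…thm1010a_mainStatement_semistable_ordinary_OPEN_of_skinnerUrban`); BSTW's own Thm. 9.21 (c) / Thm.
12.3 at `p = 3` run through [SU] Thm. 3.29 under (ram)) — so usable AS PRINTED at `p ≥ 5`, and at `p
= 3` it INHERITS PUB\* / ACTIVE-PRINT-GAP and is not to be
instantiated at `3` by any class theorem without the flag travelling. Consumer: D2
`b2b-bsdres-dens-p1`, binder `h5` of `bsz_rankLeOne_cRank_of_pieces`, multiplicative leg, by
contrapositive (corank `0` ⇒ `L(E,1) ≠ 0`), `p = 5` only. Nothing is asserted; no `_holds`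
expected.
[cite: Skinner2016PacificMC, Thm. C (§1, p. 173; arXiv p. 3 L103–L115), footnote 1, §2.5] -/
def thmC_one_le_selmerCorank_of_L_one_eq_zero : Prop :=
  ∀ (W : WeierstrassCurve ℚ) [W.IsElliptic] [W.IsGloballyMinimal] (p : ℕ) [Fact p.Prime]
    (_hp : 3 ≤ p)
    (_hred : (W.HasGoodReductionAtPrime p ∧ ¬ (p : ℤ) ∣ W.frobeniusTrace p) ∨
      W.HasMultiplicativeReductionAtPrime p)
    (_hirr : W.HasIrreducibleModPGaloisRep p)
    (_hram : ∃ ℓ : ℕ, ∃ _ : Fact ℓ.Prime, ℓ ≠ p ∧ W.HasMultiplicativeReductionAtPrime ℓ ∧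
      ¬ p ∣ padicValInt ℓ W.minimalDiscriminantInt)
    (_hL : W.entireLFunction 1 = 0),
    1 ≤ W.selmerCorank p

/-- **Contrapositive of Theorem C (2): corank `0` ⇒ `L(E,1) ≠ 0`.** At a prime `p ≥ 3` of good
ordinary or multiplicative reduction, under (irr) + (ram), `corank_{ℤ_p} Sel_{p^∞}(E/ℚ) = 0`
forces `L(E,1) ≠ 0`. [cite: Skinner2016PacificMC, Thm. C (§1, p. 173), clause (2)] -/
theorem entireLFunction_one_ne_zero_of_selmerCorank_eq_zero_of_thmC
    (h : thmC_one_le_selmerCorank_of_L_one_eq_zero)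
    (W : WeierstrassCurve ℚ) [W.IsElliptic] [W.IsGloballyMinimal] (p : ℕ) [Fact p.Prime]
    (hp : 3 ≤ p)
    (hred : (W.HasGoodReductionAtPrime p ∧ ¬ (p : ℤ) ∣ W.frobeniusTrace p) ∨
      W.HasMultiplicativeReductionAtPrime p)
    (hirr : W.HasIrreducibleModPGaloisRep p)
    (hram : ∃ ℓ : ℕ, ∃ _ : Fact ℓ.Prime, ℓ ≠ p ∧ W.HasMultiplicativeReductionAtPrime ℓ ∧
      ¬ p ∣ padicValInt ℓ W.minimalDiscriminantInt)
    (h0 : W.selmerCorank p = 0) :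
    W.entireLFunction 1 ≠ 0 := by
  intro hL
  have h1 := h W p hp hred hirr hram hL
  omega

/-- **Theorem C (2) in analytic-rank currency: corank `0` ⇒ `ord_{s=1} L(E,s) = 0`** (`p ≥ 3` good
ordinary or multiplicative, (irr) + (ram)). `L(E,1) ≠ 0` by the contrapositive of clause (2), and a
function that does not vanish at `1` has order of vanishing `0` there (Mathlib's
`analyticOrderAt_eq_zero`; no continuation hypothesis is needed for this direction).
[cite: Skinner2016PacificMC, Thm. C (§1, p. 173), clause (2)] -/
theorem analyticRank_eq_zero_of_selmerCorank_eq_zero_of_thmC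
    (h : thmC_one_le_selmerCorank_of_L_one_eq_zero)
    (W : WeierstrassCurve ℚ) [W.IsElliptic] [W.IsGloballyMinimal] (p : ℕ) [Fact p.Prime]
    (hp : 3 ≤ p)
    (hred : (W.HasGoodReductionAtPrime p ∧ ¬ (p : ℤ) ∣ W.frobeniusTrace p) ∨
      W.HasMultiplicativeReductionAtPrime p)
    (hirr : W.HasIrreducibleModPGaloisRep p)
    (hram : ∃ ℓ : ℕ, ∃ _ : Fact ℓ.Prime, ℓ ≠ p ∧ W.HasMultiplicativeReductionAtPrime ℓ ∧
      ¬ p ∣ padicValInt ℓ W.minimalDiscriminantInt)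
    (h0 : W.selmerCorank p = 0) :
    W.analyticRank = 0 := by
  have hL : W.entireLFunction 1 ≠ 0 :=
    entireLFunction_one_ne_zero_of_selmerCorank_eq_zero_of_thmC h W p hp hred hirr hram h0
  unfold WeierstrassCurve.analyticRank analyticOrderNatAt
  rw [analyticOrderAt_eq_zero.2 (Or.inr hL)]
  rfl

/-- **The multiplicative leg displayed** (the density consumer's case, `Or.inr`): at a prime
`p ≥ 3` of MULTIPLICATIVE reduction, under (irr) + (ram), `corank_{ℤ_p} Sel_{p^∞}(E/ℚ) = 0 ⇒
L(E,1) ≠ 0 ∧ ord_{s=1} L(E,s) = 0`. [cite: Skinner2016PacificMC, Thm. C (§1, p. 173), clause (2)] -/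
theorem entireLFunction_one_ne_zero_and_analyticRank_eq_zero_of_multiplicative_of_thmC
    (h : thmC_one_le_selmerCorank_of_L_one_eq_zero)
    (W : WeierstrassCurve ℚ) [W.IsElliptic] [W.IsGloballyMinimal] (p : ℕ) [Fact p.Prime]
    (hp : 3 ≤ p) (hmult : W.HasMultiplicativeReductionAtPrime p)
    (hirr : W.HasIrreducibleModPGaloisRep p)
    (hram : ∃ ℓ : ℕ, ∃ _ : Fact ℓ.Prime, ℓ ≠ p ∧ W.HasMultiplicativeReductionAtPrime ℓ ∧
      ¬ p ∣ padicValInt ℓ W.minimalDiscriminantInt)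
    (h0 : W.selmerCorank p = 0) :
    W.entireLFunction 1 ≠ 0 ∧ W.analyticRank = 0 :=
  ⟨entireLFunction_one_ne_zero_of_selmerCorank_eq_zero_of_thmC h W p hp (Or.inr hmult) hirr hram h0,
    analyticRank_eq_zero_of_selmerCorank_eq_zero_of_thmC h W p hp (Or.inr hmult) hirr hram h0⟩

end Literature.NumberTheory.EllipticCurves.Skinner2016

end
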